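import Summits.QuantumFields.YangMills.Theorems.BalabanLadderIRColdPurityBridge
import HarnessLib

/-!
# Level-descent lemma for one-box purity defects (helper on `BalabanLadder.IR`, 19354; content-free real analysis)

HONEST STATUS.  Nothing here proves the Yang–Mills mass gap (Clay), `BalabanLadder.IR`, `ColdExitSC` or any lattice gap; R4 closes only
the conditional finite-𝕋⁴ rung `BalabanLadder.UV`.  This file is bookkeeping: an inequality about nonnegative summable families, and its
reading for the cold purity defect `coldDefect ρ β L = 1 − Z_β(L³×2t)/Z_β(L³×t)²`, `t = L/4`.

THE LEMMA (ideator line `Cruxes/IR/Lines/thermal_ratchet.lean`, idea-11; sign suggested by idea-2 O6).  Let `0 ≤ w_i ≤ w'_i ≤ 1` be two families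
of normalised spectral weights on a common index type with a common vacuum index `i₀` (`w i₀ = w' i₀ = 1`) — LEVEL DESCENT: every
vacuum-normalised weight of the coarser coupling is below the matched weight of the finer one.  If the finer configuration is COLD,
`1 − (Σ w'^{2t})/(Σ w'^t)² ≤ 1/4`, then the defect is handed down: `1 − (Σ w^{2t})/(Σ w^t)² ≤ 1 − (Σ w'^{2t})/(Σ w'^t)²`
(`defect_le_of_levelDescent_hasSum`).  The one-coordinate algebra (`core`) holds up to threshold `1/2`; the finite lemma is stated at `1/3`
and the summable one at `1/4` (room for the truncation limit).  `oneBoxDefect_le_of_levelDescent` reads it on two trace sequences with matched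
`HasSpectralDatum`-type data, and `coldDefect_le_of_levelDescent` on Wilson's partition functions at `t = L/4 ≥ 2`.
Full monotonicity without the cold premise is FALSE (`hot_counterexample`).  SOFT form (idea-2 O7.3): descent on SOFT levels plus a hard tail `τ`
costs `2τ` (`defect_le_of_softLevelDescent_hasSum`); `τ = 2⁻²⁶`: a `2⁻²⁵`-pure finer box hands `2⁻²⁴`-purity down (`coldDefect_slack_of_softLevelDescent`).
-/

open Finset Filter Topology
open Literature.MathematicalPhysics.QuantumFieldTheory Literature.MathematicalPhysics.QuantumLattice
open Summit.QuantumFields.YangMills.Cruxes.IR.ColdPurityBridge (coldDefect)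

namespace Summit.QuantumFields.YangMills.Cruxes.IR.LevelDescent

/-! ## §1 One coordinate -/

/-- `u ↦ (B + u²)/(A + u)²` is antitone on `[0, B/A]`. -/
theorem G_antitone {A B u v : ℝ} (hA : 0 < A) (hB : 0 ≤ B) (hu : 0 ≤ u) (huv : u ≤ v) (hv : v * A ≤ B) :
    (B + v ^ 2) / (A + v) ^ 2 ≤ (B + u ^ 2) / (A + u) ^ 2 := by
  have hv0 : 0 ≤ v := le_trans hu huv
  have hAu : 0 < (A + u) ^ 2 := by positivity
  have hAv : 0 < (A + v) ^ 2 := by positivity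
  rw [div_le_div_iff₀ hAv hAu]
  have huA : u * A ≤ B := le_trans (mul_le_mul_of_nonneg_right huv hA.le) hv
  have hbr : 0 ≤ B * (2 * A + u + v) - A ^ 2 * (u + v) - 2 * A * u * v := by
    nlinarith [mul_nonneg hA.le (sub_nonneg.mpr hv), mul_nonneg hA.le (sub_nonneg.mpr huA),
      mul_nonneg hu (sub_nonneg.mpr hv), mul_nonneg hB (sub_nonneg.mpr huv), mul_nonneg hu hv0]
  have key : (B + u ^ 2) * (A + v) ^ 2 - (B + v ^ 2) * (A + u) ^ 2
      = (v - u) * (B * (2 * A + u + v) - A ^ 2 * (u + v) - 2 * A * u * v) := by ring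
  nlinarith [mul_nonneg (sub_nonneg.mpr huv) hbr, key]

/-- Core step: with the rest of the configuration frozen into `A = 1 + Σ_{rest} u_k ≥ 1`, `B = 1 + Σ_{rest} u_k²`, lowering one weight
`v ↦ u` does not increase the defect of a configuration that is cold at threshold `1/3`. -/
theorem core {A B v u : ℝ} (hA1 : 1 ≤ A) (hB0 : 0 ≤ B) (hv0 : 0 ≤ v) (hv1 : v ≤ 1)
    (hu0 : 0 ≤ u) (huv : u ≤ v) (hcold : 1 - (B + v ^ 2) / (A + v) ^ 2 ≤ 1 / 3) :
    1 - (B + u ^ 2) / (A + u) ^ 2 ≤ 1 - (B + v ^ 2) / (A + v) ^ 2 := by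
  have hA : 0 < A := by linarith
  have hAv : 0 < (A + v) ^ 2 := by positivity
  have h23 : 2 / 3 * (A + v) ^ 2 ≤ B + v ^ 2 := by
    have : 2 / 3 ≤ (B + v ^ 2) / (A + v) ^ 2 := by linarith
    rwa [le_div_iff₀ hAv] at this
  have hv2 : v ^ 2 ≤ v := by nlinarith
  have hvA : v * A ≤ B := by
    nlinarith [mul_nonneg hv0 (by linarith : (0:ℝ) ≤ A - 1), mul_nonneg (by linarith : (0:ℝ) ≤ A - 1) (by linarith : (0:ℝ) ≤ A - 1)]
  have := G_antitone hA hB0 hu0 huv hvA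
  linarith

/-! ## §2 Finitely many levels -/

variable {n : ℕ}

/-- One-coordinate step for `n` levels: `ν₂` is `ν₁` with coordinate `k` lowered; `ν₁ ∈ [0,1]^n` is cold at threshold `1/3`. -/
theorem step {t : ℕ} (ν₁ ν₂ : Fin n → ℝ) (k : Fin n)
    (hagree : ∀ j, j ≠ k → ν₂ j = ν₁ j) (h0 : ∀ j, 0 ≤ ν₁ j) (h1 : ∀ j, ν₁ j ≤ 1)
    (hk0 : 0 ≤ ν₂ k) (hk : ν₂ k ≤ ν₁ k)
    (hcold : 1 - (1 + ∑ j, ν₁ j ^ (2 * t)) / (1 + ∑ j, ν₁ j ^ t) ^ 2 ≤ 1 / 3) :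
    1 - (1 + ∑ j, ν₂ j ^ (2 * t)) / (1 + ∑ j, ν₂ j ^ t) ^ 2
      ≤ 1 - (1 + ∑ j, ν₁ j ^ (2 * t)) / (1 + ∑ j, ν₁ j ^ t) ^ 2 := by
  set A := 1 + ∑ j ∈ univ.erase k, ν₁ j ^ t with hAdef
  set B := 1 + ∑ j ∈ univ.erase k, ν₁ j ^ (2 * t) with hBdef
  set v := ν₁ k ^ t with hvdef
  set u := ν₂ k ^ t with hudef
  have hmem : k ∈ (univ : Finset (Fin n)) := mem_univ k
  have hz1t : 1 + ∑ j, ν₁ j ^ t = A + v := by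
    rw [← Finset.add_sum_erase _ _ hmem]; ring
  have hz1tt : 1 + ∑ j, ν₁ j ^ (2 * t) = B + v ^ 2 := by
    rw [← Finset.add_sum_erase _ _ hmem, hvdef, ← pow_mul']; ring
  have hrest_t : ∑ j ∈ univ.erase k, ν₂ j ^ t = ∑ j ∈ univ.erase k, ν₁ j ^ t :=
    Finset.sum_congr rfl fun j hj => by rw [hagree j (Finset.ne_of_mem_erase hj)]
  have hrest_tt : ∑ j ∈ univ.erase k, ν₂ j ^ (2 * t) = ∑ j ∈ univ.erase k, ν₁ j ^ (2 * t) :=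
    Finset.sum_congr rfl fun j hj => by rw [hagree j (Finset.ne_of_mem_erase hj)]
  have hz2t : 1 + ∑ j, ν₂ j ^ t = A + u := by
    rw [← Finset.add_sum_erase _ _ hmem, hrest_t]; ring
  have hz2tt : 1 + ∑ j, ν₂ j ^ (2 * t) = B + u ^ 2 := by
    rw [← Finset.add_sum_erase _ _ hmem, hrest_tt, hudef, ← pow_mul']; ring
  have hpt : ∀ j, 0 ≤ ν₁ j ^ t := fun j => pow_nonneg (h0 j) t
  have hA1 : 1 ≤ A := by
    have : 0 ≤ ∑ j ∈ univ.erase k, ν₁ j ^ t := Finset.sum_nonneg fun j _ => hpt j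
    linarith
  have hB0 : 0 ≤ B := by
    have : 0 ≤ ∑ j ∈ univ.erase k, ν₁ j ^ (2 * t) := Finset.sum_nonneg fun j _ => pow_nonneg (h0 j) _
    linarith
  have hv0 : 0 ≤ v := hpt k
  have hv1 : v ≤ 1 := pow_le_one₀ (h0 k) (h1 k)
  have hu0 : 0 ≤ u := pow_nonneg hk0 t
  have huv : u ≤ v := pow_le_pow_left₀ hk0 hk t
  rw [hz1t, hz1tt, hz2t, hz2tt]
  rw [hz1t, hz1tt] at hcold
  exact core hA1 hB0 hv0 hv1 hu0 huv hcold

/-- **Finite level-descent lemma.**  `0 ≤ μ_j ≤ μ'_j ≤ 1` for every level and the finer configuration cold at threshold `1/3`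
⇒ the defect is handed down. -/
theorem defect_le_of_levelDescent_fin {t : ℕ} (μ μ' : Fin n → ℝ) (h0 : ∀ j, 0 ≤ μ j) (hle : ∀ j, μ j ≤ μ' j)
    (h1 : ∀ j, μ' j ≤ 1) (hcold : 1 - (1 + ∑ j, μ' j ^ (2 * t)) / (1 + ∑ j, μ' j ^ t) ^ 2 ≤ 1 / 3) :
    1 - (1 + ∑ j, μ j ^ (2 * t)) / (1 + ∑ j, μ j ^ t) ^ 2
      ≤ 1 - (1 + ∑ j, μ' j ^ (2 * t)) / (1 + ∑ j, μ' j ^ t) ^ 2 := by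
  -- the chain `m ↦ (μ on the first m coordinates, μ' on the rest)`, from `μ'` (m = 0) to `μ` (m = n)
  have key : ∀ m : ℕ, m ≤ n →
      1 - (1 + ∑ j, (fun j : Fin n => if (j : ℕ) < m then μ j else μ' j) j ^ (2 * t)) /
            (1 + ∑ j, (fun j : Fin n => if (j : ℕ) < m then μ j else μ' j) j ^ t) ^ 2
        ≤ 1 - (1 + ∑ j, μ' j ^ (2 * t)) / (1 + ∑ j, μ' j ^ t) ^ 2 := by
    intro m
    induction m with
    | zero => intro _; simp
    | succ m ih =>
      intro hm
      have hm' : m < n := by omega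
      have ihm := ih (by omega)
      have hstep := step (t := t) (fun j : Fin n => if (j : ℕ) < m then μ j else μ' j)
        (fun j : Fin n => if (j : ℕ) < m + 1 then μ j else μ' j) ⟨m, hm'⟩
        (by
          intro j hj
          have hjm : (j : ℕ) ≠ m := fun h => hj (Fin.ext h)
          by_cases hj1 : (j : ℕ) < m
          · simp [hj1, show (j : ℕ) < m + 1 by omega]
          · simp [hj1, show ¬ ((j : ℕ) < m + 1) by omega])
        (by intro j; split <;> [exact h0 j; exact le_trans (h0 j) (hle j)])
        (by intro j; split <;> [exact le_trans (hle j) (h1 j); exact h1 j])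
        (by simp [h0])
        (by simp [hle])
        (le_trans ihm hcold)
      exact le_trans hstep ihm
  have := key n le_rfl
  simpa using this

/-- A HOT counterexample to full monotonicity (no cold premise): one dominant weight near `1` and `t = 1` — lowering it from `0.99` to
`0.98` INCREASES the defect. -/
theorem hot_counterexample :
    1 - (1 + ∑ j, (![99 / 100, 1 / 2] : Fin 2 → ℝ) j ^ (2 * 1)) / (1 + ∑ j, (![99 / 100, 1 / 2] : Fin 2 → ℝ) j ^ 1) ^ 2
      < 1 - (1 + ∑ j, (![98 / 100, 1 / 2] : Fin 2 → ℝ) j ^ (2 * 1)) / (1 + ∑ j, (![98 / 100, 1 / 2] : Fin 2 → ℝ) j ^ 1) ^ 2 := by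
  simp [Fin.sum_univ_two]
  norm_num

/-! ## §3 Summable families (arbitrary index type): truncation + limit -/

section Summable

variable {ι : Type} [DecidableEq ι]

/-- Finite truncation in `1 + Σ` form: for `i₀ ∈ F` and `w i₀ = 1`, re-index `F ∖ {i₀}` by `Fin`. -/
theorem sum_eq_one_add (w : ι → ℝ) (i₀ : ι) (hw₀ : w i₀ = 1) (F : Finset ι) (hF : i₀ ∈ F) (s : ℕ) :
    ∑ i ∈ F, w i ^ s = 1 + ∑ j : Fin (F.erase i₀).card, w ((F.erase i₀).equivFin.symm j : ι) ^ s := by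
  classical
  rw [← Finset.add_sum_erase F _ hF, hw₀, one_pow]
  congr 1
  rw [← Finset.sum_coe_sort (F.erase i₀)]
  exact (Equiv.sum_comp (F.erase i₀).equivFin.symm (fun i : ↥(F.erase i₀) => w (i : ι) ^ s)).symm

/-- **LEVEL-DESCENT LEMMA, summable version.**  Normalised weights `0 ≤ w_i ≤ w'_i ≤ 1` on an arbitrary index type with a common vacuum
index (`w i₀ = w' i₀ = 1`) and summable `t`-th and `2t`-th powers; if the finer configuration is cold (`1 − T′/S′² ≤ 1/4`) then
`1 − T/S² ≤ 1 − T′/S′²`. -/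
theorem defect_le_of_levelDescent_hasSum {w w' : ι → ℝ} {i₀ : ι} {t : ℕ}
    (h0 : ∀ i, 0 ≤ w i) (hle : ∀ i, w i ≤ w' i) (h1 : ∀ i, w' i ≤ 1) (hw₀ : w i₀ = 1) (hw₀' : w' i₀ = 1)
    {S T S' T' : ℝ} (hS : HasSum (fun i => w i ^ t) S) (hT : HasSum (fun i => w i ^ (2 * t)) T)
    (hS' : HasSum (fun i => w' i ^ t) S') (hT' : HasSum (fun i => w' i ^ (2 * t)) T')
    (hcold : 1 - T' / S' ^ 2 ≤ 1 / 4) : 1 - T / S ^ 2 ≤ 1 - T' / S' ^ 2 := by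
  have hS1 : 1 ≤ S := by
    have := le_hasSum hS i₀ (fun j _ => pow_nonneg (h0 j) t); simpa [hw₀] using this
  have hS'1 : 1 ≤ S' := by
    have := le_hasSum hS' i₀ (fun j _ => pow_nonneg ((h0 j).trans (hle j)) t); simpa [hw₀'] using this
  set g : Finset ι → ℝ := fun F => 1 - (∑ i ∈ F, w i ^ (2 * t)) / (∑ i ∈ F, w i ^ t) ^ 2 with hgdef
  set g' : Finset ι → ℝ := fun F => 1 - (∑ i ∈ F, w' i ^ (2 * t)) / (∑ i ∈ F, w' i ^ t) ^ 2 with hg'def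
  have hg : Tendsto g atTop (𝓝 (1 - T / S ^ 2)) :=
    tendsto_const_nhds.sub ((hT.div (hS.pow 2)) (by positivity))
  have hg' : Tendsto g' atTop (𝓝 (1 - T' / S' ^ 2)) :=
    tendsto_const_nhds.sub ((hT'.div (hS'.pow 2)) (by positivity))
  have hev₀ : ∀ᶠ F : Finset ι in atTop, i₀ ∈ F := by
    filter_upwards [eventually_ge_atTop ({i₀} : Finset ι)] with F hF
    exact hF (Finset.mem_singleton_self i₀)
  have hev₁ : ∀ᶠ F : Finset ι in atTop, g' F < 1 / 3 :=
    hg'.eventually (eventually_lt_nhds (by linarith))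
  have hev : ∀ᶠ F : Finset ι in atTop, g F ≤ g' F := by
    filter_upwards [hev₀, hev₁] with F hF hF'
    have e₁ := sum_eq_one_add w i₀ hw₀ F hF
    have e₂ := sum_eq_one_add w' i₀ hw₀' F hF
    have hgF : g F = 1 - (1 + ∑ j : Fin (F.erase i₀).card, w ((F.erase i₀).equivFin.symm j : ι) ^ (2 * t)) /
        (1 + ∑ j : Fin (F.erase i₀).card, w ((F.erase i₀).equivFin.symm j : ι) ^ t) ^ 2 := by
      simp only [hgdef, e₁]
    have hg'F : g' F = 1 - (1 + ∑ j : Fin (F.erase i₀).card, w' ((F.erase i₀).equivFin.symm j : ι) ^ (2 * t)) /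
        (1 + ∑ j : Fin (F.erase i₀).card, w' ((F.erase i₀).equivFin.symm j : ι) ^ t) ^ 2 := by
      simp only [hg'def, e₂]
    rw [hgF, hg'F]
    rw [hg'F] at hF'
    exact defect_le_of_levelDescent_fin (fun j => w ((F.erase i₀).equivFin.symm j : ι))
      (fun j => w' ((F.erase i₀).equivFin.symm j : ι)) (fun j => h0 _) (fun j => hle _) (fun j => h1 _) hF'.le
  exact le_of_tendsto_of_tendsto hg hg' hev

end Summable

/-! ## §3b Soft level descent + tail (what a factor-2 slack at threshold buys: `2⁻²⁵ + 2·2⁻²⁶ = 2⁻²⁴`) -/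

section Soft

variable {ι : Type} [DecidableEq ι]

/-- Tail algebra: adding hard levels of total `t`-weight `τ` to a configuration with soft sums `A₁ ≥ 1`, `0 ≤ A₂ ≤ A₁²` raises the defect by at most `2τ`. -/
theorem tail_algebra {A₁ A₂ τ₁ τ₂ : ℝ} (hA₁ : 1 ≤ A₁) (hA₂ : 0 ≤ A₂) (hA₂₁ : A₂ ≤ A₁ ^ 2) (hτ₁ : 0 ≤ τ₁) (hτ₂ : 0 ≤ τ₂) :
    1 - (A₂ + τ₂) / (A₁ + τ₁) ^ 2 ≤ (1 - A₂ / A₁ ^ 2) + 2 * τ₁ := by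
  have hA : 0 < A₁ := by linarith
  have hAt : 0 < A₁ + τ₁ := by linarith
  have h1 : A₂ / (A₁ + τ₁) ^ 2 ≤ (A₂ + τ₂) / (A₁ + τ₁) ^ 2 :=
    div_le_div_of_nonneg_right (by linarith) (by positivity)
  -- A₂/A₁² − A₂/(A₁+τ₁)² ≤ 2τ₁
  have h2 : A₂ / A₁ ^ 2 - A₂ / (A₁ + τ₁) ^ 2 ≤ 2 * τ₁ := by
    rw [div_sub_div _ _ (by positivity) (by positivity), div_le_iff₀ (by positivity)]
    -- A₂((A₁+τ₁)² − A₁²) ≤ 2τ₁ A₁² (A₁+τ₁)²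
    have hq : A₂ / A₁ ^ 2 ≤ 1 := (div_le_one (by positivity)).2 hA₂₁
    nlinarith [mul_nonneg hA₂ hτ₁, mul_nonneg (mul_nonneg hA₂ hτ₁) hτ₁, mul_nonneg (mul_nonneg hτ₁ hA.le) (sub_nonneg.2 hA₂₁),
      mul_nonneg hτ₁ (sub_nonneg.2 hA₂₁), pow_pos hA 2, pow_pos hAt 2, mul_nonneg (mul_nonneg hτ₁ hτ₁) (sub_nonneg.2 hA₂₁),
      mul_nonneg hτ₁ (by nlinarith : (0:ℝ) ≤ A₁ ^ 2 * (A₁ - 1)), mul_nonneg (mul_nonneg hτ₁ hτ₁) hA₂]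
  linarith

/-- **SOFT LEVEL DESCENT + TAIL.**  Descent is only assumed on a set `S ∋ i₀` of SOFT levels; the HARD levels of the coarser configuration have
total `t`-weight `τ`.  Then the defect is handed down up to `2τ`: `1 − T/S² ≤ (1 − T′/S′²) + 2τ`. -/
theorem defect_le_of_softLevelDescent_hasSum {w w' : ι → ℝ} {i₀ : ι} {t : ℕ} (S : Set ι) [DecidablePred (· ∈ S)]
    (h0 : ∀ i, 0 ≤ w i) (h0' : ∀ i, 0 ≤ w' i) (h1 : ∀ i, w' i ≤ 1)
    (hw₀ : w i₀ = 1) (hw₀' : w' i₀ = 1) (hi₀ : i₀ ∈ S) (hle : ∀ i ∈ S, w i ≤ w' i) (ht : 1 ≤ t)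
    {S₁ T₁ S' T' τ : ℝ} (hS : HasSum (fun i => w i ^ t) S₁) (hT : HasSum (fun i => w i ^ (2 * t)) T₁)
    (hS' : HasSum (fun i => w' i ^ t) S') (hT' : HasSum (fun i => w' i ^ (2 * t)) T')
    (htail : HasSum (fun i => if i ∈ S then 0 else w i ^ t) τ)
    (hcold : 1 - T' / S' ^ 2 ≤ 1 / 4) : 1 - T₁ / S₁ ^ 2 ≤ (1 - T' / S' ^ 2) + 2 * τ := by
  -- soft truncations
  set v : ι → ℝ := fun i => if i ∈ S then w i else 0 with hvdef
  set v' : ι → ℝ := fun i => if i ∈ S then w' i else 0 with hv'def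
  have hv0 : ∀ i, 0 ≤ v i := fun i => by simp only [hvdef]; split <;> [exact h0 i; exact le_rfl]
  have hv'0 : ∀ i, 0 ≤ v' i := fun i => by simp only [hv'def]; split <;> [exact h0' i; exact le_rfl]
  have hvv' : ∀ i, v i ≤ v' i := fun i => by
    simp only [hvdef, hv'def]; split <;> [exact hle i ‹_›; exact le_rfl]
  have hv'w' : ∀ i, v' i ≤ w' i := fun i => by simp only [hv'def]; split <;> [exact le_rfl; exact h0' i]
  have hvw : ∀ i, v i ≤ w i := fun i => by simp only [hvdef]; split <;> [exact le_rfl; exact h0 i]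
  have hv'1 : ∀ i, v' i ≤ 1 := fun i => (hv'w' i).trans (h1 i)
  have hvi₀ : v i₀ = 1 := by simp [hvdef, hi₀, hw₀]
  have hv'i₀ : v' i₀ = 1 := by simp [hv'def, hi₀, hw₀']
  -- summability of the truncations by comparison
  have sum_of_le : ∀ (f g : ι → ℝ) (a : ℝ), (∀ i, 0 ≤ f i) → (∀ i, f i ≤ g i) → HasSum g a → ∃ b, HasSum f b ∧ b ≤ a := by
    intro f g a hf hfg hg
    have hsf : Summable f := (hg.summable).of_nonneg_of_le hf hfg
    exact ⟨∑' i, f i, hsf.hasSum, hasSum_le hfg hsf.hasSum hg⟩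
  have hpow : ∀ (f g : ι → ℝ) (s : ℕ), (∀ i, 0 ≤ f i) → (∀ i, f i ≤ g i) → ∀ i, f i ^ s ≤ g i ^ s :=
    fun f g s hf hfg i => pow_le_pow_left₀ (hf i) (hfg i) s
  obtain ⟨A₁, hA₁, -⟩ := sum_of_le (fun i => v i ^ t) (fun i => w i ^ t) S₁ (fun i => pow_nonneg (hv0 i) _) (hpow v w t hv0 hvw) hS
  obtain ⟨A₂, hA₂, -⟩ := sum_of_le (fun i => v i ^ (2 * t)) (fun i => w i ^ (2 * t)) T₁ (fun i => pow_nonneg (hv0 i) _)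
    (hpow v w (2 * t) hv0 hvw) hT
  obtain ⟨A₁', hA₁', -⟩ := sum_of_le (fun i => v' i ^ t) (fun i => w' i ^ t) S' (fun i => pow_nonneg (hv'0 i) _) (hpow v' w' t hv'0 hv'w') hS'
  obtain ⟨A₂', hA₂', -⟩ := sum_of_le (fun i => v' i ^ (2 * t)) (fun i => w' i ^ (2 * t)) T' (fun i => pow_nonneg (hv'0 i) _)
    (hpow v' w' (2 * t) hv'0 hv'w') hT'
  -- (2) lowering the hard levels of w' to 0 is level descent: d(v') ≤ d(w')
  have h2 : 1 - A₂' / A₁' ^ 2 ≤ 1 - T' / S' ^ 2 :=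
    defect_le_of_levelDescent_hasSum hv'0 hv'w' h1 hv'i₀ hw₀' hA₁' hA₂' hS' hT' hcold
  -- (3) soft descent v ≤ v', v' cold
  have h3 : 1 - A₂ / A₁ ^ 2 ≤ 1 - A₂' / A₁' ^ 2 :=
    defect_le_of_levelDescent_hasSum hv0 hvv' hv'1 hvi₀ hv'i₀ hA₁ hA₂ hA₁' hA₂' (h2.trans hcold)
  -- (4) tail algebra: S₁ = A₁ + τ, T₁ ≥ A₂
  have hsplit : HasSum (fun i => w i ^ t) (A₁ + τ) := by
    have := hA₁.add htail
    convert this using 1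
    funext i; simp only [hvdef]; split <;> simp [show t ≠ 0 by omega]
  have hS₁ : S₁ = A₁ + τ := hS.unique hsplit
  have hτ0 : 0 ≤ τ := htail.nonneg (fun i => by split <;> [exact le_rfl; exact pow_nonneg (h0 i) _])
  have hA₁1 : 1 ≤ A₁ := by
    have := le_hasSum hA₁ i₀ (fun j _ => pow_nonneg (hv0 j) t); simpa [hvi₀] using this
  have hA₂0 : 0 ≤ A₂ := hA₂.nonneg (fun i => pow_nonneg (hv0 i) _)
  have hA₂le : A₂ ≤ A₁ := by
    refine hasSum_le (fun i => ?_) hA₂ hA₁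
    have hvi1 : v i ≤ 1 := (hvv' i).trans (hv'1 i)
    calc v i ^ (2 * t) ≤ v i ^ t := pow_le_pow_of_le_one (hv0 i) hvi1 (by omega)
      _ = v i ^ t := rfl
  have hA₂₁ : A₂ ≤ A₁ ^ 2 := hA₂le.trans (by nlinarith)
  have hT₁A₂ : A₂ ≤ T₁ := hasSum_le (hpow v w (2 * t) hv0 hvw) hA₂ hT
  have h4 : 1 - T₁ / S₁ ^ 2 ≤ (1 - A₂ / A₁ ^ 2) + 2 * τ := by
    have := tail_algebra (τ₂ := T₁ - A₂) hA₁1 hA₂0 hA₂₁ hτ0 (by linarith)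
    rw [hS₁]; convert this using 2; ring
  linarith

end Soft

/-! ## §4 Reading on trace sequences and on Wilson's one-box partition functions -/

/-- Matched `HasSpectralDatum`-type data with LEVEL DESCENT (`λ_i/λ₀ ≤ λ'_i/λ'₀`, common index type, common vacuum index) for two trace
sequences `z` (coarser coupling) and `z'` (finer) hand the one-box defect `1 − z(2t)/z(t)²` down when the finer box is cold (`t ≥ 2`). -/
theorem oneBoxDefect_le_of_levelDescent {z z' : ℕ → ℝ}
    (h : ∃ (ι : Type) (lam lam' : ι → ℝ) (i₀ : ι),
      (∀ i, 0 ≤ lam i ∧ lam i ≤ lam i₀) ∧ 0 < lam i₀ ∧ (∀ m : ℕ, HasSum (fun i => lam i ^ (m + 2)) (z (m + 2))) ∧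
      (∀ i, 0 ≤ lam' i ∧ lam' i ≤ lam' i₀) ∧ 0 < lam' i₀ ∧ (∀ m : ℕ, HasSum (fun i => lam' i ^ (m + 2)) (z' (m + 2))) ∧
      ∀ i, lam i / lam i₀ ≤ lam' i / lam' i₀)
    {t : ℕ} (ht : 2 ≤ t) (hcold : 1 - z' (2 * t) / z' t ^ 2 ≤ 1 / 4) :
    1 - z (2 * t) / z t ^ 2 ≤ 1 - z' (2 * t) / z' t ^ 2 := by
  classical
  obtain ⟨ι, lam, lam', i₀, hlam, hpos, hsum, hlam', hpos', hsum', hdesc⟩ := h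
  have h0 : ∀ i, 0 ≤ lam i / lam i₀ := fun i => div_nonneg (hlam i).1 hpos.le
  have h1 : ∀ i, lam' i / lam' i₀ ≤ 1 := fun i => (div_le_one hpos').2 (hlam' i).2
  have hw₀ : lam i₀ / lam i₀ = 1 := div_self hpos.ne'
  have hw₀' : lam' i₀ / lam' i₀ = 1 := div_self hpos'.ne'
  have key : ∀ (l : ι → ℝ) (l₀ : ℝ) (zz : ℕ → ℝ), (∀ m : ℕ, HasSum (fun i => l i ^ (m + 2)) (zz (m + 2))) →
      ∀ s : ℕ, 2 ≤ s → HasSum (fun i => (l i / l₀) ^ s) (zz s / l₀ ^ s) := by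
    intro l l₀ zz hs s hs2
    obtain ⟨m, rfl⟩ : ∃ m, s = m + 2 := ⟨s - 2, by omega⟩
    have := (hs m).div_const (l₀ ^ (m + 2))
    simpa [div_pow] using this
  have ht2 : 2 ≤ 2 * t := by omega
  have hS := key lam (lam i₀) z hsum t ht
  have hT := key lam (lam i₀) z hsum (2 * t) ht2
  have hS' := key lam' (lam' i₀) z' hsum' t ht
  have hT' := key lam' (lam' i₀) z' hsum' (2 * t) ht2
  have hratio : ∀ (zz : ℕ → ℝ) (l₀ : ℝ), 0 < l₀ →
      (zz (2 * t) / l₀ ^ (2 * t)) / (zz t / l₀ ^ t) ^ 2 = zz (2 * t) / zz t ^ 2 := by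
    intro zz l₀ hl₀
    rw [div_pow, ← pow_mul', div_div_div_cancel_right₀ (pow_ne_zero _ hl₀.ne')]
  have main := defect_le_of_levelDescent_hasSum (w := fun i => lam i / lam i₀) (w' := fun i => lam' i / lam' i₀)
    h0 hdesc h1 hw₀ hw₀' hS hT hS' hT' (by rw [hratio z' (lam' i₀) hpos']; exact hcold)
  rwa [hratio z (lam i₀) hpos, hratio z' (lam' i₀) hpos'] at main

/-- **Wilson reading.**  Matched level-descending spectral data for the one-box partition functions at a coarser coupling `β` and a finer
`β'` on the cubic box `L ≥ 8` hand the cold purity defect down: `coldDefect ρ β' L ≤ 1/4 → coldDefect ρ β L ≤ coldDefect ρ β' L`. -/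
theorem coldDefect_le_of_levelDescent {G : Type} [Group G] [TopologicalSpace G] [IsTopologicalGroup G] [CompactSpace G]
    [MeasurableSpace G] [BorelSpace G] {N : ℕ} (ρ : G →* Matrix (Fin N) (Fin N) ℂ) (β β' : ℝ) (L : ℕ) (hL : 8 ≤ L)
    (h : ∃ (ι : Type) (lam lam' : ι → ℝ) (i₀ : ι),
      (∀ i, 0 ≤ lam i ∧ lam i ≤ lam i₀) ∧ 0 < lam i₀ ∧
      (∀ m : ℕ, HasSum (fun i => lam i ^ (m + 2)) (wilsonFinTorusPartition ρ β L L L (m + 2))) ∧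
      (∀ i, 0 ≤ lam' i ∧ lam' i ≤ lam' i₀) ∧ 0 < lam' i₀ ∧
      (∀ m : ℕ, HasSum (fun i => lam' i ^ (m + 2)) (wilsonFinTorusPartition ρ β' L L L (m + 2))) ∧
      ∀ i, lam i / lam i₀ ≤ lam' i / lam' i₀)
    (hcold : coldDefect ρ β' L ≤ 1 / 4) : coldDefect ρ β L ≤ coldDefect ρ β' L := by
  have ht : 2 ≤ L / 4 := by omega
  exact oneBoxDefect_le_of_levelDescent h ht hcold

/-- SOFT matched data (descent on a soft set `S ∋ i₀`; hard levels of the COARSER sequence of total normalised `t`-weight `τ' ≤ τ`) hand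
the one-box defect down up to `2τ` (`t ≥ 2`). -/
theorem oneBoxDefect_le_of_softLevelDescent {τ : ℝ} {t : ℕ} {z z' : ℕ → ℝ}
    (h : ∃ (ι : Type) (lam lam' : ι → ℝ) (i₀ : ι) (S : Set ι) (τ' : ℝ),
      (∀ i, 0 ≤ lam i ∧ lam i ≤ lam i₀) ∧ 0 < lam i₀ ∧ (∀ m : ℕ, HasSum (fun i => lam i ^ (m + 2)) (z (m + 2))) ∧
      (∀ i, 0 ≤ lam' i ∧ lam' i ≤ lam' i₀) ∧ 0 < lam' i₀ ∧ (∀ m : ℕ, HasSum (fun i => lam' i ^ (m + 2)) (z' (m + 2))) ∧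
      i₀ ∈ S ∧ (∀ i ∈ S, lam i / lam i₀ ≤ lam' i / lam' i₀) ∧
      HasSum (Sᶜ.indicator fun i => (lam i / lam i₀) ^ t) τ' ∧ τ' ≤ τ)
    (ht : 2 ≤ t) (hcold : 1 - z' (2 * t) / z' t ^ 2 ≤ 1 / 4) :
    1 - z (2 * t) / z t ^ 2 ≤ (1 - z' (2 * t) / z' t ^ 2) + 2 * τ := by
  classical
  obtain ⟨ι, lam, lam', i₀, S, τ', hlam, hpos, hsum, hlam', hpos', hsum', hi₀, hdesc, htail, hττ⟩ := h
  have h0 : ∀ i, 0 ≤ lam i / lam i₀ := fun i => div_nonneg (hlam i).1 hpos.le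
  have h0' : ∀ i, 0 ≤ lam' i / lam' i₀ := fun i => div_nonneg (hlam' i).1 hpos'.le
  have h1 : ∀ i, lam' i / lam' i₀ ≤ 1 := fun i => (div_le_one hpos').2 (hlam' i).2
  have hw₀ : lam i₀ / lam i₀ = 1 := div_self hpos.ne'
  have hw₀' : lam' i₀ / lam' i₀ = 1 := div_self hpos'.ne'
  have key : ∀ (l : ι → ℝ) (l₀ : ℝ) (zz : ℕ → ℝ), (∀ m : ℕ, HasSum (fun i => l i ^ (m + 2)) (zz (m + 2))) →
      ∀ s : ℕ, 2 ≤ s → HasSum (fun i => (l i / l₀) ^ s) (zz s / l₀ ^ s) := by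
    intro l l₀ zz hs s hs2
    obtain ⟨m, rfl⟩ : ∃ m, s = m + 2 := ⟨s - 2, by omega⟩
    have := (hs m).div_const (l₀ ^ (m + 2))
    simpa [div_pow] using this
  have ht2 : 2 ≤ 2 * t := by omega
  have hS := key lam (lam i₀) z hsum t ht
  have hT := key lam (lam i₀) z hsum (2 * t) ht2
  have hS' := key lam' (lam' i₀) z' hsum' t ht
  have hT' := key lam' (lam' i₀) z' hsum' (2 * t) ht2
  have hratio : ∀ (zz : ℕ → ℝ) (l₀ : ℝ), 0 < l₀ →
      (zz (2 * t) / l₀ ^ (2 * t)) / (zz t / l₀ ^ t) ^ 2 = zz (2 * t) / zz t ^ 2 := by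
    intro zz l₀ hl₀
    rw [div_pow, ← pow_mul', div_div_div_cancel_right₀ (pow_ne_zero _ hl₀.ne')]
  have htail' : HasSum (fun i => if i ∈ S then 0 else (lam i / lam i₀) ^ t) τ' := by
    convert htail using 1
    funext i
    by_cases hi : i ∈ S <;> simp [hi]
  have main := defect_le_of_softLevelDescent_hasSum (w := fun i => lam i / lam i₀) (w' := fun i => lam' i / lam' i₀) S
    h0 h0' h1 hw₀ hw₀' hi₀ hdesc (by omega) hS hT hS' hT' htail' (by rw [hratio z' (lam' i₀) hpos']; exact hcold)
  rw [hratio z (lam i₀) hpos, hratio z' (lam' i₀) hpos'] at main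
  linarith

/-- **Wilson reading, soft form — what a factor-2 slack buys.**  Soft level descent from `β` (coarser) to `β'` (finer) on the cubic box
`L ≥ 8`, hard tail of the coarser box `≤ 2⁻²⁶` at `t = L/4`: a `2⁻²⁵`-pure finer box hands `2⁻²⁴`-purity down (`2⁻²⁵ + 2·2⁻²⁶ = 2⁻²⁴`). -/
theorem coldDefect_slack_of_softLevelDescent {G : Type} [Group G] [TopologicalSpace G] [IsTopologicalGroup G] [CompactSpace G]
    [MeasurableSpace G] [BorelSpace G] {N : ℕ} (ρ : G →* Matrix (Fin N) (Fin N) ℂ) (β β' : ℝ) (L : ℕ) (hL : 8 ≤ L)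
    (h : ∃ (ι : Type) (lam lam' : ι → ℝ) (i₀ : ι) (S : Set ι) (τ' : ℝ),
      (∀ i, 0 ≤ lam i ∧ lam i ≤ lam i₀) ∧ 0 < lam i₀ ∧
      (∀ m : ℕ, HasSum (fun i => lam i ^ (m + 2)) (wilsonFinTorusPartition ρ β L L L (m + 2))) ∧
      (∀ i, 0 ≤ lam' i ∧ lam' i ≤ lam' i₀) ∧ 0 < lam' i₀ ∧
      (∀ m : ℕ, HasSum (fun i => lam' i ^ (m + 2)) (wilsonFinTorusPartition ρ β' L L L (m + 2))) ∧
      i₀ ∈ S ∧ (∀ i ∈ S, lam i / lam i₀ ≤ lam' i / lam' i₀) ∧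
      HasSum (Sᶜ.indicator fun i => (lam i / lam i₀) ^ (L / 4)) τ' ∧ τ' ≤ 1 / 2 ^ 26)
    (hcold : coldDefect ρ β' L ≤ 1 / 2 ^ 25) : coldDefect ρ β L ≤ 1 / 2 ^ 24 := by
  have ht : 2 ≤ L / 4 := by omega
  have h : coldDefect ρ β L ≤ coldDefect ρ β' L + 2 * (1 / 2 ^ 26) :=
    oneBoxDefect_le_of_softLevelDescent h ht (hcold.trans (by norm_num))
  have : (1 : ℝ) / 2 ^ 25 + 2 * (1 / 2 ^ 26) = 1 / 2 ^ 24 := by norm_num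
  linarith

end Summit.QuantumFields.YangMills.Cruxes.IR.LevelDescent
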